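import Mathlib.MeasureTheory.Measure.Real
import Mathlib.MeasureTheory.Constructions.BorelSpace.Basic
import HarnessLib

/-!
# Intermediate values of a finely divisible measure (Sierpiński's theorem, divisible form)

Theorems only, everything PROVED; no definitions. The classical fact (W. Sierpiński, *Sur les fonctions
d'ensemble additives et continues*, Fund. Math. 3 (1922) 240–246; textbook form: "a finite measure without
atoms takes every value between `0` and `μ(X)`") in the form that is convenient when non-atomicity is
available QUANTITATIVELY: a measure is called *finely divisible* on a set when every measurable subset of
positive measure contains measurable subsets of arbitrarily small positive measure (for a Haar measure this
follows from the existence of open sets of arbitrarily small measure, since countably many translates of any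
nonempty open set cover a second countable group — see the companion
`Literature/IUT/LogVolume/TensorPacketMeasureValues.lean`).

* `exists_halfMaximal_increment` — the greedy step: below a level `T`, every measurable `B` with
  `μ(B) ≤ T` admits a disjoint measurable increment `F` with `μ(B) + μ(F) ≤ T` whose measure is at least
  half of that of any other such increment (a supremum argument in `ℝ`);
* `exists_measurableSet_measureReal_eq` / `exists_measurableSet_measure_eq` — for a FINITE finely
  divisible measure every `t ∈ [0, μ(univ)]` is the measure of a measurable set (greedy exhaustion: the
  union of the iterated half-maximal increments has measure exactly `t`, for otherwise a small subset of its
  complement would have been at least half-absorbed at every step);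
* `exists_subset_measurableSet_measure_eq` — the same inside any measurable set `U` of finite measure of
  an arbitrary measure finely divisible on `U`;
* `exists_isCompact_subset_measure_lt_add` / `exists_isCompact_subset_measure_eq` (§4, topological form) —
  if every compact set is covered by finitely many open sets of measure `< δ` for every `δ > 0`, then a compact
  set of finite measure contains COMPACT subsets of every smaller measure (shave off a minimal finite family of
  small open pieces to land in `[s, s + δ)`, then intersect a decreasing sequence of such shavings; Hausdorff).

The hypothesis is stated inline (no named predicate). [cite: Sierpinski1922Fonctions, Théorème p. 240]
Deliberately NOT here: the derivation of
fine divisibility from `NoAtoms`/`NullSingletonClass` (not needed by the consumers), Lyapunov convexity.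
-/

noncomputable section

open MeasureTheory Set Filter Topology
open scoped ENNReal

namespace Literature.MeasureTheory.Lebesgue

variable {α : Type*} [MeasurableSpace α]

/-! ## 1. The greedy step -/

/-- **Half-maximal increments.** For a finite measure `μ`, a level `T` and a measurable set `B` with
`μ(B) ≤ T`, there is a measurable set `F` disjoint from `B` with `μ(B) + μ(F) ≤ T` such that every
measurable `G` disjoint from `B` with `μ(B) + μ(G) ≤ T` has `μ(G) ≤ 2·μ(F)` (the step of Sierpiński's exhaustion
argument). [cite: Sierpinski1922Fonctions, Théorème p. 240 (proof)] -/
theorem exists_halfMaximal_increment (μ : Measure α) [IsFiniteMeasure μ] (T : ℝ) (B : Set α)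
    (hBT : μ.real B ≤ T) :
    ∃ F : Set α, MeasurableSet F ∧ Disjoint B F ∧ μ.real B + μ.real F ≤ T ∧
      ∀ G : Set α, MeasurableSet G → Disjoint B G → μ.real B + μ.real G ≤ T → μ.real G ≤ 2 * μ.real F := by
  classical
  -- the set of measures of admissible increments
  set V : Set ℝ := {r | ∃ G : Set α, MeasurableSet G ∧ Disjoint B G ∧ μ.real B + μ.real G ≤ T ∧
    r = μ.real G} with hV
  have hne : V.Nonempty := ⟨0, ∅, MeasurableSet.empty, disjoint_empty B, by simpa using hBT, by simp⟩
  have hbdd : BddAbove V := by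
    refine ⟨μ.real univ, ?_⟩
    rintro r ⟨G, -, -, -, rfl⟩
    exact measureReal_mono (subset_univ G)
  have hmem : ∀ G : Set α, MeasurableSet G → Disjoint B G → μ.real B + μ.real G ≤ T → μ.real G ∈ V :=
    fun G hG hd hT => ⟨G, hG, hd, hT, rfl⟩
  by_cases hc : 0 < sSup V
  · -- pick an increment of measure more than half the supremum
    obtain ⟨r, hrV, hr⟩ := exists_lt_of_lt_csSup hne (half_lt_self hc)
    obtain ⟨F, hF, hdF, hTF, rfl⟩ := hrV
    refine ⟨F, hF, hdF, hTF, fun G hG hdG hTG => ?_⟩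
    have h1 : μ.real G ≤ sSup V := le_csSup hbdd (hmem G hG hdG hTG)
    linarith
  · -- the supremum is `≤ 0`: every admissible increment is null, the empty increment will do
    push Not at hc
    refine ⟨∅, MeasurableSet.empty, disjoint_empty B, by simpa using hBT, fun G hG hdG hTG => ?_⟩
    have h1 : μ.real G ≤ sSup V := le_csSup hbdd (hmem G hG hdG hTG)
    simp only [measureReal_empty, mul_zero]
    linarith

/-! ## 2. Intermediate values of a finite finely divisible measure -/

/-- **Sierpiński's theorem, divisible form (real-valued).** Let `μ` be a finite measure such that every
measurable set of positive measure contains measurable subsets of arbitrarily small positive measure. Then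
every `T ∈ [0, μ(univ)]` is the measure of some measurable set — Sierpiński's "une fonction d'ensemble additive et
continue prend toute valeur intermédiaire", with continuity (non-atomicity) assumed in the divisible form.
[cite: Sierpinski1922Fonctions, Théorème p. 240] -/
theorem exists_measurableSet_measureReal_eq (μ : Measure α) [IsFiniteMeasure μ]
    (hdiv : ∀ E : Set α, MeasurableSet E → μ E ≠ 0 →
      ∀ ε : ℝ≥0∞, ε ≠ 0 → ∃ F ⊆ E, MeasurableSet F ∧ μ F ≠ 0 ∧ μ F < ε)
    {T : ℝ} (hT0 : 0 ≤ T) (hT : T ≤ μ.real univ) :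
    ∃ B : Set α, MeasurableSet B ∧ μ.real B = T := by
  classical
  -- the greedy increment at every measurable `B` below the level
  choose! f hf using fun B : Set α => exists_halfMaximal_increment μ T B
  -- the iterated increments
  let s : ℕ → Set α := fun n => Nat.rec (∅ : Set α) (fun _ B => B ∪ f B) n
  have hs0 : s 0 = ∅ := rfl
  have hsucc : ∀ n, s (n + 1) = s n ∪ f (s n) := fun n => rfl
  have hmeas : ∀ n, MeasurableSet (s n) ∧ μ.real (s n) ≤ T := by
    intro n
    induction n with
    | zero => exact ⟨by rw [hs0]; exact MeasurableSet.empty, by rw [hs0]; simpa using hT0⟩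
    | succ n ih =>
      obtain ⟨h1, h2, h3, -⟩ := hf (s n) ih.2
      refine ⟨by rw [hsucc]; exact ih.1.union h1, ?_⟩
      rw [hsucc, measureReal_union h2 h1]
      exact h3
  have hstep : ∀ n, μ.real (s (n + 1)) = μ.real (s n) + μ.real (f (s n)) := fun n => by
    obtain ⟨h1, h2, -, -⟩ := hf (s n) (hmeas n).2
    rw [hsucc, measureReal_union h2 h1]
  have hmono : Monotone s := monotone_nat_of_le_succ fun n => by
    rw [hsucc]; exact subset_union_left
  -- the exhaustion and its measure
  set B : Set α := ⋃ n, s n with hBdef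
  have hBm : MeasurableSet B := MeasurableSet.iUnion fun n => (hmeas n).1
  have hlim : Tendsto (fun n => μ (s n)) atTop (𝓝 (μ B)) := tendsto_measure_iUnion_atTop hmono
  have hlimr : Tendsto (fun n => μ.real (s n)) atTop (𝓝 (μ.real B)) :=
    (ENNReal.tendsto_toReal (measure_ne_top μ B)).comp hlim
  have hBle : μ.real B ≤ T := le_of_tendsto' hlimr fun n => (hmeas n).2
  have hsle : ∀ n, μ.real (s n) ≤ μ.real B := fun n => measureReal_mono (subset_iUnion s n)
  refine ⟨B, hBm, le_antisymm hBle ?_⟩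
  by_contra hlt
  push Not at hlt
  -- a small subset of the complement would have been half-absorbed at every step
  have hδ : 0 < T - μ.real B := sub_pos.2 hlt
  have hE : μ Bᶜ ≠ 0 := by
    intro h0
    have h1 : μ.real Bᶜ = 0 := by simp [Measure.real, h0]
    have h2 := measureReal_add_measureReal_compl (μ := μ) hBm
    linarith
  obtain ⟨F, hFsub, hFm, hF0, hFlt⟩ :=
    hdiv Bᶜ hBm.compl hE (ENNReal.ofReal (T - μ.real B)) (by simpa using hδ)
  have hFpos : 0 < μ.real F := ENNReal.toReal_pos hF0 (measure_ne_top μ F)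
  have hFltδ : μ.real F < T - μ.real B := by
    have h1 := (ENNReal.toReal_lt_toReal (measure_ne_top μ F) ENNReal.ofReal_ne_top).2 hFlt
    rwa [ENNReal.toReal_ofReal hδ.le] at h1
  have hdisj : ∀ n, Disjoint (s n) F := fun n =>
    Set.disjoint_left.2 fun x hx hxF => hFsub hxF (mem_iUnion.2 ⟨n, hx⟩)
  have hgrow : ∀ n, μ.real F ≤ 2 * μ.real (f (s n)) := fun n =>
    (hf (s n) (hmeas n).2).2.2.2 F hFm (hdisj n) (by linarith [hsle n])
  have hlow : ∀ n : ℕ, (n : ℝ) * (μ.real F / 2) ≤ μ.real (s n) := by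
    intro n
    induction n with
    | zero => simp [hs0]
    | succ n ih =>
      rw [hstep n]
      push_cast
      linarith [hgrow n]
  obtain ⟨n, hn⟩ := exists_nat_gt (T / (μ.real F / 2))
  have hm : 0 < μ.real F / 2 := by linarith
  have h1 : T < (n : ℝ) * (μ.real F / 2) := by rwa [div_lt_iff₀ hm] at hn
  linarith [hlow n, (hmeas n).2]

/-- **Sierpiński's theorem, divisible form.** For a finite measure `μ` such that every measurable set of
positive measure contains measurable subsets of arbitrarily small positive measure, every `t ≤ μ(univ)` is the
measure of some measurable set (`ℝ≥0∞`-valued form). [cite: Sierpinski1922Fonctions, Théorème p. 240] -/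
theorem exists_measurableSet_measure_eq (μ : Measure α) [IsFiniteMeasure μ]
    (hdiv : ∀ E : Set α, MeasurableSet E → μ E ≠ 0 →
      ∀ ε : ℝ≥0∞, ε ≠ 0 → ∃ F ⊆ E, MeasurableSet F ∧ μ F ≠ 0 ∧ μ F < ε)
    {t : ℝ≥0∞} (ht : t ≤ μ univ) : ∃ B : Set α, MeasurableSet B ∧ μ B = t := by
  have htop : t ≠ ∞ := ne_top_of_le_ne_top (measure_ne_top μ univ) ht
  have hT : t.toReal ≤ μ.real univ := (ENNReal.toReal_le_toReal htop (measure_ne_top μ univ)).2 ht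
  obtain ⟨B, hBm, hB⟩ := exists_measurableSet_measureReal_eq μ hdiv ENNReal.toReal_nonneg hT
  refine ⟨B, hBm, ?_⟩
  have h1 : (μ B).toReal = t.toReal := hB
  exact (ENNReal.toReal_eq_toReal_iff' (measure_ne_top μ B) htop).1 h1

/-! ## 3. Inside a set of finite measure -/

/-- **Sierpiński's theorem, divisible form, inside a set of finite measure.** If `μ(U) < ∞` and every
measurable subset of `U` of positive measure contains measurable subsets of arbitrarily small positive
measure, then every `t ≤ μ(U)` is the measure of a measurable subset of `U`. [cite: Sierpinski1922Fonctions, Théorème p. 240] -/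
theorem exists_subset_measurableSet_measure_eq (μ : Measure α) {U : Set α} (hU : MeasurableSet U)
    (hUfin : μ U ≠ ∞)
    (hdiv : ∀ E ⊆ U, MeasurableSet E → μ E ≠ 0 →
      ∀ ε : ℝ≥0∞, ε ≠ 0 → ∃ F ⊆ E, MeasurableSet F ∧ μ F ≠ 0 ∧ μ F < ε)
    {t : ℝ≥0∞} (ht : t ≤ μ U) : ∃ B ⊆ U, MeasurableSet B ∧ μ B = t := by
  haveI : IsFiniteMeasure (μ.restrict U) := ⟨by rwa [Measure.restrict_apply_univ, lt_top_iff_ne_top]⟩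
  have hdiv' : ∀ E : Set α, MeasurableSet E → μ.restrict U E ≠ 0 →
      ∀ ε : ℝ≥0∞, ε ≠ 0 → ∃ F ⊆ E, MeasurableSet F ∧ μ.restrict U F ≠ 0 ∧ μ.restrict U F < ε := by
    intro E hE hE0 ε hε
    rw [Measure.restrict_apply hE] at hE0
    obtain ⟨F, hFsub, hFm, hF0, hFlt⟩ := hdiv (E ∩ U) inter_subset_right (hE.inter hU) hE0 ε hε
    have hFU : F ∩ U = F := inter_eq_left.2 (hFsub.trans inter_subset_right)
    refine ⟨F, hFsub.trans inter_subset_left, hFm, ?_, ?_⟩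
    · rwa [Measure.restrict_apply hFm, hFU]
    · rwa [Measure.restrict_apply hFm, hFU]
  have ht' : t ≤ μ.restrict U univ := by rwa [Measure.restrict_apply_univ]
  obtain ⟨B, hBm, hB⟩ := exists_measurableSet_measure_eq (μ.restrict U) hdiv' ht'
  refine ⟨B ∩ U, inter_subset_right, hBm.inter hU, ?_⟩
  rwa [Measure.restrict_apply hBm] at hB

/-! ## 4. Compact sets of prescribed measure (finely coverable measures on topological spaces) -/

section Compact

variable [TopologicalSpace α] [OpensMeasurableSpace α]

omit [OpensMeasurableSpace α] in
/-- **Shaving a compact set down to just above a prescribed measure.** Suppose every compact set can be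
covered by finitely many open sets each of measure `< δ`, for every `δ > 0` (e.g. a Haar measure admitting
nonempty open sets of arbitrarily small measure). Then a compact `K` of finite measure with `s ≤ μ(K)` contains a
compact `K' ` with `s ≤ μ(K') < s + δ`: remove the open pieces of a minimal sub-cover whose removal brings the measure
below `s + δ` (removing one piece fewer keeps it `≥ s + δ`, and one piece costs `< δ`).
[cite: Sierpinski1922Fonctions, Théorème p. 240 (compact variant)] -/
theorem exists_isCompact_subset_measure_lt_add (μ : Measure α)
    (hcov : ∀ K : Set α, IsCompact K → ∀ δ : ℝ≥0∞, δ ≠ 0 →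
      ∃ t : Finset (Set α), (∀ O ∈ t, IsOpen O ∧ μ O < δ) ∧ K ⊆ ⋃ O ∈ t, O)
    {K : Set α} (hK : IsCompact K) (hKfin : μ K ≠ ∞) {s : ℝ≥0∞} (hs : s ≤ μ K) {δ : ℝ≥0∞} (hδ : δ ≠ 0) :
    ∃ K' ⊆ K, IsCompact K' ∧ s ≤ μ K' ∧ μ K' < s + δ := by
  classical
  obtain ⟨t, ht, hKt⟩ := hcov K hK δ hδ
  -- the sub-covers whose removal brings the measure below `s + δ`
  set fam : Finset (Finset (Set α)) := t.powerset.filter fun T => μ (K \ ⋃ O ∈ T, O) < s + δ with hfam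
  have hmem : ∀ T, T ∈ fam ↔ T ⊆ t ∧ μ (K \ ⋃ O ∈ T, O) < s + δ := fun T => by
    rw [hfam, Finset.mem_filter, Finset.mem_powerset]
  have hne : fam.Nonempty := by
    refine ⟨t, (hmem t).2 ⟨subset_rfl, ?_⟩⟩
    have h0 : K \ ⋃ O ∈ t, O = ∅ := Set.sdiff_eq_empty.2 hKt
    rw [h0, measure_empty]
    exact lt_of_lt_of_le (pos_iff_ne_zero.2 hδ) le_add_self
  obtain ⟨T, hT, hmin⟩ := Finset.exists_min_image fam Finset.card hne
  obtain ⟨hTt, hTlt⟩ := (hmem T).1 hT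
  have hopen : IsOpen (⋃ O ∈ T, O) := isOpen_biUnion fun O hO => (ht O (hTt hO)).1
  refine ⟨K \ ⋃ O ∈ T, O, Set.sdiff_subset, hK.diff hopen, ?_, hTlt⟩
  -- `s ≤ μ(K \ ⋃ T)`: trivial if `T = ∅`, else remove one piece fewer
  rcases T.eq_empty_or_nonempty with hT0 | ⟨O₀, hO₀⟩
  · subst hT0
    simpa using hs
  · have hT' : T.erase O₀ ∉ fam := by
      intro h
      have h1 := hmin _ h
      rw [Finset.card_erase_of_mem hO₀] at h1
      have h2 := Finset.card_pos.2 ⟨O₀, hO₀⟩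
      omega
    have hge : s + δ ≤ μ (K \ ⋃ O ∈ T.erase O₀, O) := by
      by_contra hlt
      exact hT' ((hmem _).2 ⟨(Finset.erase_subset O₀ T).trans hTt, not_le.1 hlt⟩)
    have hsub : K \ ⋃ O ∈ T.erase O₀, O ⊆ (K \ ⋃ O ∈ T, O) ∪ O₀ := by
      intro x hx
      by_cases hxO : x ∈ O₀
      · exact Or.inr hxO
      · refine Or.inl ⟨hx.1, fun hxU => hx.2 ?_⟩
        obtain ⟨O, hO, hxO'⟩ := Set.mem_iUnion₂.1 hxU
        have hOne : O ≠ O₀ := fun h => hxO (h ▸ hxO')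
        exact Set.mem_iUnion₂.2 ⟨O, Finset.mem_erase.2 ⟨hOne, hO⟩, hxO'⟩
    have hle : μ (K \ ⋃ O ∈ T.erase O₀, O) ≤ μ (K \ ⋃ O ∈ T, O) + μ O₀ :=
      (measure_mono hsub).trans (measure_union_le _ _)
    have hO₀lt : μ O₀ < δ := (ht O₀ (hTt hO₀)).2
    have hfinT : μ (K \ ⋃ O ∈ T, O) ≠ ∞ := ne_top_of_le_ne_top hKfin (measure_mono Set.sdiff_subset)
    by_contra hlt
    push Not at hlt
    have h3 : s + δ < μ (K \ ⋃ O ∈ T, O) + δ :=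
      lt_of_le_of_lt hge (lt_of_le_of_lt hle (ENNReal.add_lt_add_left hfinT hO₀lt))
    have h4 : s < μ (K \ ⋃ O ∈ T, O) := by
      by_contra h5
      push Not at h5
      exact absurd h3 (not_lt.2 (add_le_add h5 le_rfl))
    exact absurd h4 (not_lt.2 hlt.le)

/-- **Compact sets of prescribed measure.** Under the same fine-coverability hypothesis, in a Hausdorff space
every compact `K` of finite measure contains, for every `s ≤ μ(K)`, a COMPACT subset of measure EXACTLY `s`
(intersect a decreasing sequence of compact shavings with `s ≤ μ(K_n) < s + 1/n`).
[cite: Sierpinski1922Fonctions, Théorème p. 240 (compact variant)] -/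
theorem exists_isCompact_subset_measure_eq [T2Space α] (μ : Measure α)
    (hcov : ∀ K : Set α, IsCompact K → ∀ δ : ℝ≥0∞, δ ≠ 0 →
      ∃ t : Finset (Set α), (∀ O ∈ t, IsOpen O ∧ μ O < δ) ∧ K ⊆ ⋃ O ∈ t, O)
    {K : Set α} (hK : IsCompact K) (hKfin : μ K ≠ ∞) {s : ℝ≥0∞} (hs : s ≤ μ K) :
    ∃ K' ⊆ K, IsCompact K' ∧ μ K' = s := by
  classical
  -- the shaving step at precision `(n+1)⁻¹`
  choose! f hf using fun (K' : Set α) (n : ℕ) (h : IsCompact K' ∧ μ K' ≠ ∞ ∧ s ≤ μ K') =>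
    exists_isCompact_subset_measure_lt_add μ hcov h.1 h.2.1 h.2.2
      (ENNReal.inv_ne_zero.2 (ENNReal.natCast_ne_top (n + 1)))
  let seq : ℕ → Set α := fun n => Nat.rec K (fun m K' => f K' m) n
  have hseq0 : seq 0 = K := rfl
  have hsucc : ∀ n, seq (n + 1) = f (seq n) n := fun n => rfl
  have hinv : ∀ n, seq n ⊆ K ∧ IsCompact (seq n) ∧ μ (seq n) ≠ ∞ ∧ s ≤ μ (seq n) := by
    intro n
    induction n with
    | zero => exact ⟨by rw [hseq0], by rw [hseq0]; exact hK, by rw [hseq0]; exact hKfin, by rw [hseq0]; exact hs⟩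
    | succ n ih =>
      obtain ⟨h1, h2, h3, -⟩ := hf (seq n) n ⟨ih.2.1, ih.2.2.1, ih.2.2.2⟩
      rw [hsucc]
      exact ⟨h1.trans ih.1, h2, ne_top_of_le_ne_top ih.2.2.1 (measure_mono h1), h3⟩
  have hstep : ∀ n, seq (n + 1) ⊆ seq n ∧ μ (seq (n + 1)) < s + ((n : ℝ≥0∞) + 1)⁻¹ := fun n => by
    obtain ⟨h1, -, -, h4⟩ := hf (seq n) n ⟨(hinv n).2.1, (hinv n).2.2.1, (hinv n).2.2.2⟩
    rw [hsucc]
    exact ⟨h1, by exact_mod_cast h4⟩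
  have hanti : Antitone seq := antitone_nat_of_succ_le fun n => (hstep n).1
  refine ⟨⋂ n, seq n, (Set.iInter_subset seq 0).trans (hinv 0).1,
    hK.of_isClosed_subset (isClosed_iInter fun n => (hinv n).2.1.isClosed)
      ((Set.iInter_subset seq 0).trans (hinv 0).1), ?_⟩
  -- the measures converge to `μ (⋂ seq)` and are squeezed to `s`
  have h1 : Tendsto (fun n => μ (seq n)) atTop (𝓝 (μ (⋂ n, seq n))) :=
    tendsto_measure_iInter_atTop (fun n => (hinv n).2.1.isClosed.measurableSet.nullMeasurableSet) hanti
      ⟨0, (hinv 0).2.2.1⟩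
  have hupper : Tendsto (fun n : ℕ => s + (n : ℝ≥0∞)⁻¹) atTop (𝓝 s) := by
    simpa using ENNReal.tendsto_inv_nat_nhds_zero.const_add s
  have h2 : Tendsto (fun n => μ (seq n)) atTop (𝓝 s) := by
    refine tendsto_of_tendsto_of_tendsto_of_le_of_le tendsto_const_nhds hupper
      (fun n => (hinv n).2.2.2) fun n => ?_
    cases n with
    | zero => simp
    | succ m =>
      show μ (seq (m + 1)) ≤ s + (((m + 1 : ℕ) : ℝ≥0∞))⁻¹
      rw [Nat.cast_succ]
      exact (hstep m).2.le
  exact tendsto_nhds_unique h1 h2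

end Compact

end Literature.MeasureTheory.Lebesgue

end
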